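import Summits.Ventures.YMGap.RobustBall.HeatBathPoincareZdBall
import Summits.Ventures.YMGap.RobustBall.HeatBathPoincareZdDLR
import Summits.Ventures.YMGap.RobustBall.BoundaryDecayKR
import HarnessLib

/-!
# Robust ball (Y2) — THE HEAT-BATH POINCARÉ INEQUALITY OF EVERY INFINITE-VOLUME GIBBS STATE OF EVERY MEMBER OF THE `ℤ^d` BALL

HONEST FRAMING: venture file of the cell `pub-ymgap` (QuantumFields programme), track ROBUST-BALL, seat rb-p2 (g14); the BALL-UNIFORM version of
`HeatBathPoincareZdDLR.lean` (Wilson) on top of `HeatBathPoincareZdBall.lean` (the member's KERNEL inequality, uniform in volume and boundary field).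
LATTICE statements at STRONG COUPLING for the DLR states `μ ∈ 𝒢(γ^W)` of the perturbed specifications `γ^W = perturbedYM χ_N (Nβ) W supp` ('t Hooft `β`)
of the MEMBERS of rb-p1's `ℤ^d` ball: link potentials `W : Potential (ZdEdge d) SU(N)` with continuous own-link terms, a locally finite support map `supp`
of range `R` (`‖e − y‖ ≤ R` for `y` in an active polymer at `e`), and per-link LOAD WITNESSES — oscillation `∑_{X ∋ e} osc X e ≤ a`, self-Lipschitz
`∑_{X ∋ e} lip X e ≤ ℓ_s`, ROW cross-Lipschitz `∑_{y} ∑_{X ∋ e} lip X y ≤ Λ` and COLUMN cross-Lipschitz `∑_{e ∈ T} ∑_{X ∋ e} lip X y ≤ Λc` (`T ∌ y`);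
constants independent of the member; nothing about `β → ∞`, the continuum or Clay.

THE STATEMENT (★★★ `gibbsVariance_le_onBall`): `d ≥ 1`, `OneLinkKRModulus N b K` on `b ≥ 2(d−1)|β|`,
`c := 6(d−1)|β| K e^{a}(1 + 2√N ℓ_s) + √N Λc < 1` (column condition — the Poincaré constant) and `6(d−1)|β| K e^{a}(1 + 2√N ℓ_s) + √N Λ < 1` (row condition —
boundary insensitivity, no constant of the conclusion depends on it).  Then for EVERY member, EVERY DLR state `μ ∈ 𝒢(γ^W)` and every Lipschitz cylinder `F`
on the links `Δ`:
`Var_μ(F) ≤ (2(1 − c))⁻¹ ∑_{x ∈ Δ} ∫ (∫ (F(U) − F(σ))² γ^W_{x}(dσ|U)) μ(dU)`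
— the infinite-volume single-link heat-bath (Glauber) dynamics OF THE MEMBER has spectral gap `≥ 1 − c` on local Lipschitz observables in EVERY Gibbs
state (standard reading), with ONE constant for the whole ball.  ★★ `su2_gibbsVariance_le_onBall_quarter`: `SU(2)`, every `d`, quarter modulus
(`c = (3/2)(d−1)β_W e^{a}(1 + 2√2 ℓ_s) + √2 Λc`, row condition `(3/2)(d−1)β_W e^{a}(1 + 2√2 ℓ_s) + √2 Λ < 1`, tree coupling `β_W/2`).
MECHANISM (g12's Wilson proof run for the member): the law of total variance through the DLR equations (`IsGibbsMeasure.setIntegral_integral_spec`),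
the member's kernel inequality `HeatBathPoincareZdBall.kernelVariance_le_onBall` on the boxes `boxLinks d (n + m₀) ⊇ Δ` uniformly in the boundary
field, vanishing of the conditional-variance functional off `Δ`, and ds-3's member boundary insensitivity
`BoundaryDecayKR.abs_boundary_sub_integral_le_of_oneLinkKRModulus` (`(max ρ ½)^{⌊n / max(1,R)⌋₊} → 0` kills the boundary term).  0 sorry, 0 definitions.
References: L. Wu, Ann. Probab. 34 (2006) 1960; H. Föllmer, LNM 1362 (1988) Ch. I; H.-O. Georgii (2011) Rem. 1.24, Rem. 8.26;
D. W. Stroock, B. Zegarlinski, CMP 144 (1992) 303.  Everything here is proved. [folklore]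
-/

noncomputable section

open MeasureTheory Function Real Filter Finset ProbabilityTheory Topology
open scoped ENNReal NNReal
open Literature.Probability.LatticeModels
open Literature.Probability.LatticeModels.DobrushinMetric
open Literature.MathematicalPhysics.QuantumLattice
open Literature.MathematicalPhysics.QuantumFieldTheory hiding ZdEdge
open Literature.MathematicalPhysics.QuantumFieldTheory.Balaban1983to89.StrongCouplingDobrushinWindow (OneLinkKRModulus)
open Summit.Ventures.YMGap.RobustBall.HeatBathPoincareZdBall (kernelVariance_le_onBall)

namespace Summit.Ventures.YMGap.RobustBall.HeatBathPoincareZd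

variable {d N : ℕ}

/-! ### The Poincaré inequality of every infinite-volume Gibbs state of a member -/

section Gibbs

/-- ★★★ **THE HEAT-BATH POINCARÉ INEQUALITY OF EVERY INFINITE-VOLUME GIBBS STATE OF EVERY MEMBER OF THE `ℤ^d` BALL** (`SU(N)`, 't Hooft `β`, bare `Nβ`).
`OneLinkKRModulus N b K` on `b ≥ 2(d−1)|β|`; a member `W` (continuous own-link terms, support `supp` of range `R`) with per-link loads `a` (oscillation),
`ℓ_s` (self-Lipschitz), `Λ` (row cross-Lipschitz) and `Λc` (column cross-Lipschitz); column condition `6(d−1)|β| K e^{a}(1 + 2√N ℓ_s) + √N Λc ≤ c < 1`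
and row condition `6(d−1)|β| K e^{a}(1 + 2√N ℓ_s) + √N Λ < 1`.  Then EVERY DLR state `μ ∈ 𝒢(γ^W)` and every Lipschitz cylinder `F` on the links `Δ`
satisfy `Var_μ(F) ≤ (2(1−c))⁻¹ ∑_{x ∈ Δ} ∫ (∫ (F(U) − F(σ))² γ^W_{x}(dσ|U)) μ(dU)` — the member's infinite-volume heat-bath dynamics has spectral gap
`≥ 1 − c` on local Lipschitz observables, uniformly over the ball. [folklore] -/
theorem gibbsVariance_le_onBall (hd : 1 ≤ d) (hN : 1 ≤ N) {β b K a ℓs Λ Λc R c : ℝ} (hK : 0 ≤ K) (hℓs : 0 ≤ ℓs)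
    (hb : |β| * (2 * ((d : ℝ) - 1)) ≤ b) (hmod : OneLinkKRModulus N b K)
    {W : Potential (ZdEdge d) (Matrix.specialUnitaryGroup (Fin N) ℂ)} (hWc : ∀ X, Continuous (W X))
    (hWdep : ∀ X, DependsOn (W X) (↑X : Set (ZdEdge d)))
    {supp : Finset (ZdEdge d) → Finset (Finset (ZdEdge d))} (hsupp : W.IsSupportedBy supp)
    {osc : Finset (ZdEdge d) → ZdEdge d → ℝ} (hosc : ∀ X, Dobrushin.IsOscBound (W X) (osc X))
    (hosca : ∀ e, ∑ X ∈ (supp {e}).filter (fun X => e ∈ X), osc X e ≤ a)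
    {lip : Finset (ZdEdge d) → ZdEdge d → ℝ} (hlip : ∀ X, IsLipBound suFrobDist (W X) (lip X))
    (hlips : ∀ e, ∑ X ∈ (supp {e}).filter (fun X => e ∈ X), lip X e ≤ ℓs)
    (hΛ : ∀ e, ∑ y ∈ perturbedNbr supp e, ∑ X ∈ (supp {e}).filter (fun X => e ∈ X), lip X y ≤ Λ)
    (hcol : ∀ (y : ZdEdge d) (T : Finset (ZdEdge d)), y ∉ T → ∑ e ∈ T, ∑ X ∈ (supp {e}).filter (fun X => e ∈ X), lip X y ≤ Λc)
    (hR : ∀ e, ∀ X ∈ supp {e}, e ∈ X → ∀ y ∈ X, ‖e.1 - y.1‖ ≤ R)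
    (hc : 6 * ((d : ℝ) - 1) * |β| * (K * exp a * (1 + 2 * Real.sqrt N * ℓs)) + Real.sqrt N * Λc ≤ c) (hc1 : c < 1)
    (hrow : 6 * ((d : ℝ) - 1) * |β| * (K * exp a * (1 + 2 * Real.sqrt N * ℓs)) + Real.sqrt N * Λ < 1)
    {μ : Measure (LGConfig d (Matrix.specialUnitaryGroup (Fin N) ℂ))}
    (hμ : μ ∈ perturbedGibbsMeasures (d := d) (fundamentalRep (Fin N)) (N * β) W supp)
    {F : LGConfig d (Matrix.specialUnitaryGroup (Fin N) ℂ) → ℝ} {Δ : Finset (ZdEdge d)} {KF : ℝ≥0}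
    (hF : IsLipschitzCylinder (fundamentalRep (Fin N)) F Δ KF) :
    ProbabilityTheory.variance F μ ≤
      (2 * (1 - c))⁻¹ * ∑ x ∈ Δ, ∫ U, ∫ σ, (F U - F σ) ^ 2 ∂(perturbedYM (fundamentalRep (Fin N)) (N * β) W supp {x} U) ∂μ := by
  classical
  haveI : SecondCountableTopology (Matrix (Fin N) (Fin N) ℂ) :=
    inferInstanceAs (SecondCountableTopology (Fin N → Fin N → ℂ))
  haveI : SecondCountableTopology (Matrix.specialUnitaryGroup (Fin N) ℂ) :=
    Topology.IsEmbedding.subtypeVal.secondCountableTopology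
  have hρc := continuous_fundamentalRep (Fin N)
  have hW : W.IsAdapted := fun X => ⟨hWdep X, (hWc X).measurable⟩
  have hWb : ∀ X, ∃ C, ∀ U, |W X U| ≤ C := fun X => exists_bound_of_continuous (hWc X)
  set γ := perturbedYM (d := d) (fundamentalRep (Fin N)) (N * β) W supp with hγdef
  have hγ : IsSpecification γ := isSpecification_perturbedYM _ hρc _ hW hWb hsupp
  have hμ' : IsGibbsMeasure γ μ := hμ
  haveI := hμ'.isProbabilityMeasure
  have hFm : Measurable F := hF.measurable
  have hM : ∀ U, |F U| ≤ |F 1| + 2 * KF := hF.abs_le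
  set M : ℝ := |F 1| + 2 * KF with hMdef
  obtain ⟨m₀, hm₀⟩ := exists_subset_boxLinks Δ
  have hlt : 0 < 2 * (1 - c) := by linarith
  -- the row-condition contraction constant of the boundary term
  set ρ : ℝ := 6 * ((d : ℝ) - 1) * |β| * (K * exp a * (1 + 2 * Real.sqrt N * ℓs)) + Real.sqrt N * Λ with hρdef
  set r : ℝ := max ρ (1 / 2) with hr
  have hr0 : 0 ≤ r := le_max_of_le_right (by norm_num)
  have hr1 : r < 1 := max_lt hrow (by norm_num)
  set R' : ℝ := max 1 R with hR'
  have hR'pos : 0 < R' := lt_of_lt_of_le one_pos (le_max_left _ _)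
  set E : ℝ := 2 * Real.sqrt N * KF * Δ.card with hE
  -- the conditional-variance functional
  set h : ZdEdge d → LGConfig d (Matrix.specialUnitaryGroup (Fin N) ℂ) → ℝ := fun x U => ∫ σ, (F U - F σ) ^ 2 ∂(γ {x} U) with hh
  have hhm : ∀ x, Measurable (h x) := fun x => measurable_integral_sq_sub hγ x hFm hM
  have hhb : ∀ x U, |h x U| ≤ 4 * M ^ 2 := fun x U => abs_integral_sq_sub_le hγ x hM U
  have hhnn : ∀ x U, 0 ≤ h x U := fun x U => integral_nonneg fun σ => sq_nonneg _
  have hh0 : ∀ x, x ∉ Δ → ∀ U, h x U = 0 := fun x hx U =>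
    integral_sq_sub_eq_zero hγ hFm hF.dependsOn (fun h' => hx (Finset.mem_coe.1 h')) U
  -- the estimate on the box of radius `n + m₀`, for every `n`
  have claim : ∀ n : ℕ, ProbabilityTheory.variance F μ ≤
      (2 * (1 - c))⁻¹ * ∑ x ∈ Δ, ∫ U, h x U ∂μ + E ^ 2 * (r ^ 2) ^ ⌊(n : ℝ) / R'⌋₊ := by
    intro n
    set V := boxLinks d (n + m₀) with hV
    have hΔV : Δ ⊆ V := hm₀.trans (boxLinks_subset_boxLinks (Nat.le_add_left m₀ n))
    have hVne : V.Nonempty := boxLinks_nonempty hd _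
    set mval := ∫ U, F U ∂μ with hmval
    -- (1) the law of total variance through the DLR equations
    have h1 : ProbabilityTheory.variance F μ = ∫ ω, ∫ σ, (F σ - mval) ^ 2 ∂(γ V ω) ∂μ := by
      rw [ProbabilityTheory.variance_eq_integral hFm.aemeasurable]
      have hsq_m : Measurable fun σ => (F σ - mval) ^ 2 := (hFm.sub measurable_const).pow_const 2
      have hsq_b : ∀ σ, |(F σ - mval) ^ 2| ≤ (M + |mval|) ^ 2 := fun σ => by
        rw [abs_pow]
        exact pow_le_pow_left₀ (abs_nonneg _) ((abs_sub _ _).trans (add_le_add (hM σ) le_rfl)) 2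
      have key := hμ'.setIntegral_integral_spec hγ V (B := Set.univ) MeasurableSet.univ hsq_m hsq_b
      simp only [Measure.restrict_univ] at key
      exact key.symm
    -- (2) the pointwise bound on the kernel side: the member's kernel Poincaré + boundary insensitivity
    have h2 : ∀ ω, ∫ σ, (F σ - mval) ^ 2 ∂(γ V ω) ≤
        (2 * (1 - c))⁻¹ * ∑ x ∈ Δ, ∫ U, h x U ∂(γ V ω) + E ^ 2 * (r ^ 2) ^ ⌊(n : ℝ) / R'⌋₊ := by
      intro ω
      haveI := hγ.isProbability V ω
      rw [integral_sq_sub_const_eq hFm hM mval]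
      have hA : ProbabilityTheory.variance F (γ V ω) ≤ (2 * (1 - c))⁻¹ * ∑ x ∈ V, ∫ U, h x U ∂(γ V ω) :=
        kernelVariance_le_onBall hd hN hK hℓs hb hmod hWc hWdep hsupp hosc hosca hlip hlips hcol hc hc1 hVne ω hFm ⟨M, hM⟩
      have hsum : ∑ x ∈ V, ∫ U, h x U ∂(γ V ω) = ∑ x ∈ Δ, ∫ U, h x U ∂(γ V ω) := by
        rw [← Finset.sum_subset hΔV]
        intro x _ hx
        simp [hh0 x hx]
      have hB : (∫ U, F U ∂(γ V ω) - mval) ^ 2 ≤ E ^ 2 * (r ^ 2) ^ ⌊(n : ℝ) / R'⌋₊ := by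
        have hD : ∀ y ∈ Δ, ∀ z, z ∉ V → (n : ℝ) ≤ ‖y.1 - z.1‖ := fun y hy z hz => by
          have h := sub_le_norm_sub_of_mem_boxLinks (hm₀ hy) hz
          push_cast at h
          linarith
        have hb : |(∫ U, F U ∂(γ V ω)) - mval| ≤ E * r ^ ⌊(n : ℝ) / R'⌋₊ :=
          abs_boundary_sub_integral_le_of_oneLinkKRModulus hd hN hK hℓs hb hmod hWc hWdep hsupp hosc hosca hlip hlips hΛ hR
            le_rfl hrow hμ V ω hF hD
        calc (∫ U, F U ∂(γ V ω) - mval) ^ 2 = |(∫ U, F U ∂(γ V ω)) - mval| ^ 2 := (sq_abs _).symm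
          _ ≤ (E * r ^ ⌊(n : ℝ) / R'⌋₊) ^ 2 := pow_le_pow_left₀ (abs_nonneg _) hb 2
          _ = E ^ 2 * (r ^ 2) ^ ⌊(n : ℝ) / R'⌋₊ := by ring
      calc ProbabilityTheory.variance F (γ V ω) + (∫ U, F U ∂(γ V ω) - mval) ^ 2
          ≤ (2 * (1 - c))⁻¹ * ∑ x ∈ V, ∫ U, h x U ∂(γ V ω) + E ^ 2 * (r ^ 2) ^ ⌊(n : ℝ) / R'⌋₊ := add_le_add hA hB
        _ = (2 * (1 - c))⁻¹ * ∑ x ∈ Δ, ∫ U, h x U ∂(γ V ω) + E ^ 2 * (r ^ 2) ^ ⌊(n : ℝ) / R'⌋₊ := by rw [hsum]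
    -- (3) integrate over `μ`
    have hint : ∀ x, Integrable (fun ω => ∫ U, h x U ∂(γ V ω)) μ := fun x =>
      integrable_of_abs_le' (measurable_integral_spec hγ V (hhm x)) (M := 4 * M ^ 2) fun ω => by
        haveI := hγ.isProbability V ω
        exact abs_integral_le_of_nonneg_of_le (hhnn x) fun U => (abs_le.1 (hhb x U)).2
    have hsum_int : Integrable (fun ω => ∑ x ∈ Δ, ∫ U, h x U ∂(γ V ω)) μ := integrable_finsetSum _ fun x _ => hint x
    have h3 : ∫ ω, ∫ σ, (F σ - mval) ^ 2 ∂(γ V ω) ∂μ ≤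
        ∫ ω, ((2 * (1 - c))⁻¹ * ∑ x ∈ Δ, ∫ U, h x U ∂(γ V ω) + E ^ 2 * (r ^ 2) ^ ⌊(n : ℝ) / R'⌋₊) ∂μ :=
      integral_mono_of_nonneg (ae_of_all _ fun ω => integral_nonneg fun σ => sq_nonneg _)
        ((hsum_int.const_mul _).add (integrable_const _)) (ae_of_all _ h2)
    -- (4) evaluate the right-hand side with the DLR equations
    have hDLR : ∀ x, ∫ ω, ∫ U, h x U ∂(γ V ω) ∂μ = ∫ U, h x U ∂μ := fun x => by
      have key := hμ'.setIntegral_integral_spec hγ V (B := Set.univ) MeasurableSet.univ (hhm x) (hhb x)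
      simp only [Measure.restrict_univ] at key
      exact key
    have h4 : ∫ ω, ((2 * (1 - c))⁻¹ * ∑ x ∈ Δ, ∫ U, h x U ∂(γ V ω) + E ^ 2 * (r ^ 2) ^ ⌊(n : ℝ) / R'⌋₊) ∂μ =
        (2 * (1 - c))⁻¹ * ∑ x ∈ Δ, ∫ U, h x U ∂μ + E ^ 2 * (r ^ 2) ^ ⌊(n : ℝ) / R'⌋₊ := by
      have hc' : ∫ _ω, E ^ 2 * (r ^ 2) ^ ⌊(n : ℝ) / R'⌋₊ ∂μ = E ^ 2 * (r ^ 2) ^ ⌊(n : ℝ) / R'⌋₊ := by simp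
      rw [integral_add (hsum_int.const_mul _) (integrable_const _), integral_const_mul, integral_finsetSum _ (fun x _ => hint x), hc']
      simp_rw [hDLR]
    calc ProbabilityTheory.variance F μ = _ := h1
      _ ≤ _ := h3
      _ = _ := h4
  -- (5) `n → ∞`
  have hr2 : r ^ 2 < 1 := pow_lt_one₀ hr0 hr1 two_ne_zero
  have hk : Tendsto (fun n : ℕ => ⌊(n : ℝ) / R'⌋₊) atTop atTop :=
    tendsto_nat_floor_atTop.comp (tendsto_natCast_atTop_atTop.atTop_div_const hR'pos)
  have hlim : Tendsto (fun n : ℕ => (2 * (1 - c))⁻¹ * ∑ x ∈ Δ, ∫ U, h x U ∂μ + E ^ 2 * (r ^ 2) ^ ⌊(n : ℝ) / R'⌋₊) atTop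
      (𝓝 ((2 * (1 - c))⁻¹ * ∑ x ∈ Δ, ∫ U, h x U ∂μ + E ^ 2 * 0)) :=
    tendsto_const_nhds.add (((tendsto_pow_atTop_nhds_zero_of_lt_one (pow_nonneg hr0 2) hr2).comp hk).const_mul _)
  rw [mul_zero, add_zero] at hlim
  exact le_of_tendsto_of_tendsto' tendsto_const_nhds hlim claim

/-- ★★ **`SU(2)`, EVERY DIMENSION, QUARTER MODULUS** (tree coupling `β_W/2`, 't Hooft `β_W/4`; `K = 1` on `‖B‖_op ≤ 1`, radius `(d−1)β_W/2 ≤ 1`): for a member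
with loads `(a, ℓ_s, Λ, Λc)` and range `R`, column condition `(3/2)(d−1)β_W e^{a}(1 + 2√2 ℓ_s) + √2 Λc ≤ c < 1` and row condition
`(3/2)(d−1)β_W e^{a}(1 + 2√2 ℓ_s) + √2 Λ < 1`, EVERY DLR state `μ ∈ 𝒢(γ^W)` and every Lipschitz cylinder `F` on `Δ` satisfy
`Var_μ(F) ≤ (2(1−c))⁻¹ ∑_{x ∈ Δ} ∫ (∫ (F(U) − F(σ))² γ^W_{x}(dσ|U)) μ(dU)`. [folklore] -/
theorem su2_gibbsVariance_le_onBall_quarter (hd : 1 ≤ d) {βW a ℓs Λ Λc R c : ℝ} (h0 : 0 ≤ βW) (hβ : ((d : ℝ) - 1) * βW / 2 ≤ 1)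
    (hℓs : 0 ≤ ℓs) {W : Potential (ZdEdge d) (Matrix.specialUnitaryGroup (Fin 2) ℂ)} (hWc : ∀ X, Continuous (W X))
    (hWdep : ∀ X, DependsOn (W X) (↑X : Set (ZdEdge d)))
    {supp : Finset (ZdEdge d) → Finset (Finset (ZdEdge d))} (hsupp : W.IsSupportedBy supp)
    {osc : Finset (ZdEdge d) → ZdEdge d → ℝ} (hosc : ∀ X, Dobrushin.IsOscBound (W X) (osc X))
    (hosca : ∀ e, ∑ X ∈ (supp {e}).filter (fun X => e ∈ X), osc X e ≤ a)
    {lip : Finset (ZdEdge d) → ZdEdge d → ℝ} (hlip : ∀ X, IsLipBound suFrobDist (W X) (lip X))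
    (hlips : ∀ e, ∑ X ∈ (supp {e}).filter (fun X => e ∈ X), lip X e ≤ ℓs)
    (hΛ : ∀ e, ∑ y ∈ perturbedNbr supp e, ∑ X ∈ (supp {e}).filter (fun X => e ∈ X), lip X y ≤ Λ)
    (hcol : ∀ (y : ZdEdge d) (T : Finset (ZdEdge d)), y ∉ T → ∑ e ∈ T, ∑ X ∈ (supp {e}).filter (fun X => e ∈ X), lip X y ≤ Λc)
    (hR : ∀ e, ∀ X ∈ supp {e}, e ∈ X → ∀ y ∈ X, ‖e.1 - y.1‖ ≤ R)
    (hc : 3 / 2 * ((d : ℝ) - 1) * βW * (exp a * (1 + 2 * Real.sqrt 2 * ℓs)) + Real.sqrt 2 * Λc ≤ c) (hc1 : c < 1)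
    (hrow : 3 / 2 * ((d : ℝ) - 1) * βW * (exp a * (1 + 2 * Real.sqrt 2 * ℓs)) + Real.sqrt 2 * Λ < 1)
    {μ : Measure (LGConfig d (Matrix.specialUnitaryGroup (Fin 2) ℂ))}
    (hμ : μ ∈ perturbedGibbsMeasures (d := d) (fundamentalRep (Fin 2)) (βW / 2) W supp)
    {F : LGConfig d (Matrix.specialUnitaryGroup (Fin 2) ℂ) → ℝ} {Δ : Finset (ZdEdge d)} {KF : ℝ≥0}
    (hF : IsLipschitzCylinder (fundamentalRep (Fin 2)) F Δ KF) :
    ProbabilityTheory.variance F μ ≤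
      (2 * (1 - c))⁻¹ * ∑ x ∈ Δ, ∫ U, ∫ σ, (F U - F σ) ^ 2 ∂(perturbedYM (fundamentalRep (Fin 2)) (βW / 2) W supp {x} U) ∂μ := by
  have hdd : (0 : ℝ) ≤ (d : ℝ) - 1 := by
    have : (1 : ℝ) ≤ d := by exact_mod_cast hd
    linarith
  have habs : |βW / 4| = βW / 4 := abs_of_nonneg (by positivity)
  have hβ' : ((2 : ℕ) : ℝ) * (βW / 4) = βW / 2 := by push_cast; ring
  have hμ4 : μ ∈ perturbedGibbsMeasures (d := d) (fundamentalRep (Fin 2)) ((2 : ℕ) * (βW / 4)) W supp := by rwa [hβ']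
  have key := gibbsVariance_le_onBall (N := 2) hd (by norm_num) (β := βW / 4) zero_le_one hℓs (b := ((d : ℝ) - 1) * βW / 2)
    (by rw [habs]; nlinarith) (SlabAreaLawDimensions.su2_oneLinkKRModulus_of_le_one hβ) hWc hWdep hsupp hosc hosca hlip hlips hΛ hcol hR
    (c := c) (by rw [habs]; push_cast; nlinarith [hc]) hc1 (by rw [habs]; push_cast; nlinarith [hrow]) hμ4 hF
  rw [hβ'] at key
  exact key

end Gibbs

end Summit.Ventures.YMGap.RobustBall.HeatBathPoincareZd

end
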